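import Mathlib
import HarnessLib
import HarnessLib.Audit
import Summits.AtomisticToContinuum.Statement

/-!
Route: AlphaScalingLadder

CLOSED (retired) 2026-08-16T03:05:24Z by planner-rchoice-AtomisticToContinuum-AlphaScal-0035482b-0 — reason: not-a-thesis: target-unreachable — no item concludes the target LadderTop and no honest glue exists (the cruxes RungLog/RungTree/RungRings are σ=0 corollaries OF the target; any `Crux… → LadderTop` glue must carry a σ>0 item containing the  — note: route-choice (unit rchoice-AtomisticToContinuum-AlphaScal-0035482b; operator hold 2026-08-16T02:49:49Z, route.target-unreachable: no item concludes the target LadderTop). CHOSEN: retire. WHY NO GLUE: the three ranked cruxes RungLog/RungTree/RungRings (stmt-AtomisticToContinuum-8914/8915/8916) are σ . The file is kept as the record of this route; refuted decls are indexed as negative knowledge (`ledger negatives`).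

# Route AlphaScalingLadder — climb α_N = Nε² from κ·log N to σ²N^(1/3) — branching horizon and ring
thresholds as typed rungs

It suffices to show LADDERTOP (decl LadderTop; card alpha-ladder-branching-horizon realised): the
hydrodynamic limit holds UNIFORMLY ALONG EVERY ADMISSIBLE SCALING of the hard-sphere gas on 𝕋³ — for
every diameter sequence 0 < ε_N < 1/2 with collision number α_N := (N+1)ε_N² → ∞ and reduced volume
(N+1)ε_N³ → σ³, σ ∈ [0, σ₀(profiles)), local-Gibbs data follow the classical Euler solution with
equation of state hsPressure σ (the ideal gas at σ = 0, in-tree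
`Literature.Barriers.AtomisticToContinuum.hsPressure_zero`) in probability up to the first shock.
The conjunct is the corner ε = hsDiameter σ, σ > 0 (ConjunctOnLadder; the deciding theorem `closes`
is a two-line specialisation, D-0027 §2.1). The LINE is the ladder INSIDE the target: its σ = 0
members between Deng–Hani–Ma's α ≲ (log log N)^(1/2) and Hilbert's σ²N^(1/3) are filed as three
ranked typed cruxes — RungLog (α_N ~ κ log N: the first statement past the BRANCHING HORIZON α_N t ≍
log N), RungTree (α_N ~ cN^δ, δ < 1/5: no rings at all), RungRings (1/5 ≤ δ < 1/3: statistically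
dilute rings, still ideal EOS) — distinct open theorems, none implying the conjunct, each isolating
one factor of its difficulty ("chaos beyond shared ancestry" × "rings" × "equation of state"), to be
climbed in this order and wanted as calibration targets by every engine route.
Lean: `∀ (a₀ θ₀ : Literature.MathematicalPhysics.KineticTheory.T3 → ℝ) (u₀ :
Literature.MathematicalPhysics.KineticTheory.T3 → Literature.MathematicalPhysics.KineticTheory.V3),
Continuous a₀ → Continuous θ₀ → Continuous u₀ → (∀ x, 0 < a₀ x) → (∀ x, 0 < θ₀ x) → ∃ σ₀ : ℝ, 0 < σ₀
∧ ∀ σ : ℝ, 0 ≤ σ → σ < σ₀ → ∀ ε : ℕ → ℝ, (∀ N : ℕ, 0 < ε N ∧ ε N < 2⁻¹) → Filter.Tendsto (fun N : ℕ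
=> ((N : ℝ) + 1) * ε N ^ 2) Filter.atTop Filter.atTop → Filter.Tendsto (fun N : ℕ => ((N : ℝ) + 1) *
ε N ^ 3) Filter.atTop (nhds (σ ^ 3)) → ∀ (T : ℝ) (ρ θ : ℝ →
Literature.MathematicalPhysics.KineticTheory.T3 → ℝ) (u : ℝ →
Literature.MathematicalPhysics.KineticTheory.T3 → Literature.MathematicalPhysics.KineticTheory.V3),
Literature.MathematicalPhysics.KineticTheory.IsHardSphereEulerSolution σ T ρ u θ → ∀ Φ : (N : ℕ) →
Literature.Analysis.FluidPDE.HardSphereFlow (Literature.Analysis.FluidPDE.Torus.geometry (Fin 3)) (ε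
N) (N + 1), Literature.MathematicalPhysics.KineticTheory.TendstoHydroFieldsAt (fun N =>
Literature.Analysis.FluidPDE.particleLaw (Φ N) (Literature.Analysis.FluidPDE.canonicalDensity
(Literature.Analysis.FluidPDE.Torus.geometry (Fin 3)) (ε N) (N + 1)
(Literature.MathematicalPhysics.KineticTheory.localGibbsProfile a₀ u₀ θ₀))) Φ ρ u θ 0 → ∀ t ∈
Set.Ico 0 T, Literature.MathematicalPhysics.KineticTheory.TendstoHydroFieldsAt (fun N =>
Literature.Analysis.FluidPDE.particleLaw (Φ N) (Literature.Analysis.FluidPDE.canonicalDensity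
(Literature.Analysis.FluidPDE.Torus.geometry (Fin 3)) (ε N) (N + 1)
(Literature.MathematicalPhysics.KineticTheory.localGibbsProfile a₀ u₀ θ₀))) Φ ρ u θ t`

## Assembly
DECIDING THEOREM (D-0027 §2.1, file glue.lean, sorry-free, elaborated in Sketch.lean rc 0): `theorem
closes : LadderTop → ConjunctOnLadder → HydrodynamicLimit` — hypotheses = the route's items
LadderTop (target) and ConjunctOnLadder (support), conclusion = the sub-problem Statement decl
`HydrodynamicLimit` (root abbrev of Summits/AtomisticToContinuum/HydrodynamicLimit/Statement.lean)
by name. Proof: pure logic plus ConjunctOnLadder — specialise the uniform target LadderTop to the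
conjunct's scaling ε = hsDiameter σ (σ > 0), where the local Gibbs law, the flows and the Euler
system are definitionally those of `HydrodynamicLimit`; σ₀ is shrunk below 1/2 so that hsDiameter σ
N < 1/2. The rungs are not hypotheses of `closes` (they are σ = 0 members of LadderTop,
RungsAreLadderScalings) — as for the high rungs of a dimension or exponent ladder, they are the
ranked steps of the line and the target's corner is the summit. The Assembly item records the same
chain as a Prop. This route re-files card alpha-ladder-branching-horizon after
route-AtomisticToContinuum-AlphaLadder (same items, assembly concluding the Literature constant) was
retired `not-a-thesis` by the 2026-08-15 D-0027 audit; the items are unchanged and re-attached by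
signature.

Rationale: WHY THIS LINE. Every printed particle → kinetic (→ fluid) theorem controls correlations through
(near-)disjointness of collision histories — Lanford1975, GallagherSaintRaymondTexier2013,
PulvirentiSimonella2016, BGSSAnnals2023/BGSSCPAM2023 and the frontier DengHaniMa2024
(arXiv:2503.01800 Thm 3 p. 11 under (1.24) p. 8: α·T ≲ (log|log ε|)^(1/2);
BodineauGallagherSaintRaymondInvent2016 = arXiv:1305.3397 p. 7: α ≪ √(log log N) for the tagged
sphere) — and two elementary counts locate where that logic must end, far below fixed density: the
backward cluster of a particle (arXiv:2005.09962 §1.1, Thm 2.1; doi:10.1142/s0218202515500256) grows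
like e^(cα_N t) and saturates at N at the BRANCHING HORIZON α_N t ≍ log N (the clock-model count of
doi:10.1103/physrevlett.80.2035; Dorfman1999 Ch. 18), after which EVERY pair shares ancestors; and
three-body resp. genuine ring events occur per particle at rates ≍ α_Nφ_N = α_N^(5/2)N^(−1/2) resp.
α_Nφ_N² = α_N⁴N^(−1) (Cohen1967 §2, Dorfman1999 §16), vanishing iff α_N ≪ N^(1/5) resp. N^(1/4).
Hence the whole interval (log N, N^(1/5)) is past the horizon yet ring-free and ideal: the
conjunct's first unknown — chaos by DILUTION of shared ancestry instead of by disjointness — is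
isolated there (RungLog, RungTree), rings enter separately on [1/5, 1/3) (RungRings), and the
equation of state only at the corner δ = 1/3 (the `closes` corner). Imported area: branching-process
/ percolation counting on collision graphs from the kinetic theory of dynamical systems (van Zon–van
Beijeren–Dellago clock model; Aoki–Pulvirenti–Simonella–Tsuji backward clusters) used as a REGIME
MAP with typed rungs; no engine is prescribed — the rungs are the calibration targets that
information-percolation-collision-dag, kinetic-windows-inside-yau, ring-sparse-collision-forest and
DenseKineticExpansion (0804) can each be pointed at first, which none of the five existing routes
(all fixed-σ, scaling-blind) provides; the negatives index is empty.

RANKED CRUXES. #0 LadderTop (target) — LADDER TOP — the hydrodynamic limit UNIFORMLY ALONG EVERY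
ADMISSIBLE SCALING: for all continuous profiles (a₀, θ₀ > 0, u₀) there is σ₀ > 0 such that for every
σ ∈ [0, σ₀) and every diameter sequence 0 < ε_N < 1/2 with α_N := (N+1)ε_N² → ∞ and (N+1)ε_N³ → σ³,
every classical hs-Euler solution with equation of state hsPressure σ on [0,T) and every family of
flows: local-Gibbs fields converging at t = 0 converge at every t < T. Its σ > 0 corner with ε =
hsDiameter σ is the conjunct (ConjunctOnLadder, Assembly); its σ = 0 members contain the three rungs
(RungsAreLadderScalings) with the IDEAL-gas law (in-tree
Literature.Barriers.AtomisticToContinuum.hsPressure_zero). (why it might fail: It contains the open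
conjunct (σ > 0 corner) and every rung; beyond them it asks robustness under scalings whose reduced
volume (N+1)ε³ → σ³ is not constant — an exotic admissible sequence could fail with the conjunct
true (then restate over eventually monotone scalings).) [Spohn1991, OllaVaradhanYau1993,
DengHaniMa2024, arXiv:2503.01800]
#2 RungLog (crux) — RUNG (i) — EULER PAST THE BRANCHING HORIZON (card K1): for every κ > 0 and every
diameter sequence 0 < ε_N < 1/2 with (N+1)ε_N²/log(N+2) → κ (logarithmic collision number α_N ~ κ
log N, volume fraction → 0, Kn ≍ 1/(κ log N) → 0), hard spheres on 𝕋³ with local-Gibbs data follow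
the classical IDEAL-gas Euler solution (IsHardSphereEulerSolution 0) in probability at every t < T,
for every classical lifespan T — in particular beyond the horizon time t* ≍ 1/(cκ) after which every
pair of particles shares collision ancestors. [difficulty: open-problem] (why it might fail: Weaker
in density than the conjunct and physically expected, but methodless: every printed derivation
(Lanford1975 … DHM, arXiv:2503.01800 (1.24): αT ≲ (log log N)^1/2) needs disjoint collision
histories, false for ALL pairs once α_N t > log N/c; an unprinted dilution principle is required.)
[DengHaniMa2024, arXiv:2503.01800, BodineauGallagherSaintRaymondInvent2016, arXiv:2005.09962,
doi:10.1103/physrevlett.80.2035, Lanford1975, GallagherSaintRaymondTexier2013]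
#3 RungTree (crux) — RUNG (ii) — THE TREE REGIME: for every 0 < δ < 1/5, c > 0 and every diameter
sequence 0 < ε_N < 1/2 with (N+1)ε_N²/(N+1)^δ → c, the same conclusion (ideal-gas Euler, every t <
T). Here the horizon time ≍ δ log N/(cN^δ) → 0 (the whole interval is past the horizon) while the
expected number of three-body/ring events per particle on [0,T] is ≍ T·N^(5δ/2−1/2) → 0: a typical
particle's entire macroscopic history is a collision TREE. [deps: RungLog] [difficulty:
open-problem] (why it might fail: Kn ≍ N^-δ: Euler closure over N^δ collision generations per unit
time with total history overlap; even equilibrium fluctuation/LD theory of hard spheres is printed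
only at Boltzmann–Grad α = O(1) (BGSSAnnals2023, BGSSCPAM2023); if a dilution proof of RungLog does
not extend, Thesis A is wrong.) [BGSSAnnals2023, BGSSCPAM2023, Cohen1967, arXiv:2005.09962,
DengHaniMa2024, PulvirentiSimonella2016]
#4 RungRings (crux) — RUNG (iii) — STATISTICALLY DILUTE RINGS: for every 1/5 ≤ δ < 1/3, c > 0 and
every diameter sequence 0 < ε_N < 1/2 with (N+1)ε_N²/(N+1)^δ → c, the same conclusion, still with
the IDEAL-gas law ((N+1)ε_N³ = c^(3/2)N^(3δ/2−1/2)(1+o(1)) → 0); now three-body correlated sequences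
(δ ≥ 1/5) and genuine recollision rings (δ ≥ 1/4) occur infinitely often per particle per unit time
but are vanishing fractions ≍ φ_N, φ_N² of its α_N collisions. [deps: RungTree] [difficulty:
open-problem] (why it might fail: Ring statistics under the NON-equilibrium law are contact
statistics invisible to entropy/energy bounds (Cohen1967 §4, Dorfman1999 §16: NoDensityExpansion
physics); an O(φ_N) fraction of biased collisions among α_N → ∞ per unit time is o(1) in the fluxes
only if rings are unbiased to leading order.) [Cohen1967, Dorfman1999, VanbeijerenErnst1973,
arXiv:2503.01800, PulvirentiSimonella2016, BGSSCPAM2023]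
#9 ConjunctOnLadder (support) — the conjunct's own scaling is a ladder scaling with limit σ: for 0 <
σ < 1/2 one has 0 < hsDiameter σ N < 1/2 for all N, (N+1)·hsDiameter σ N² → ∞ (in-tree
Literature.Barriers.AtomisticToContinuum.inverseKnudsen_hsDiameter_tendsto_atTop) and
(N+1)·hsDiameter σ N³ → σ³ (it is identically σ³,
Literature.MathematicalPhysics.KineticTheory.succ_mul_hsDiameter_pow_three); with it the Assembly is
a two-line specialisation. [difficulty: provable-now] [Spohn1991, GST2013]
#9 RungClassesInhabited (support) — non-vacuity of the rung hypotheses: for every κ > 0 (resp. every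
δ ∈ (0, 1/3) and c > 0) there is a diameter sequence with 0 < ε_N < 1/2 for all N and
(N+1)ε_N²/log(N+2) → κ (resp. (N+1)ε_N²/(N+1)^δ → c) — e.g. ε_N = min(1/4, (κ
log(N+2)/(N+1))^(1/2)), which agrees with the square root for all large N. [difficulty:
provable-now] [Spohn1991, Alexander1975]
#9 RungsAreLadderScalings (support) — every rung scaling is a ladder scaling with σ = 0: a positive
diameter sequence of logarithmic class ((N+1)ε²/log(N+2) → κ > 0) or power class ((N+1)ε²/(N+1)^δ →
c > 0, 0 < δ < 1/3) has (N+1)ε_N² → ∞ and (N+1)ε_N³ → 0; hence LadderTop (σ = 0 member) implies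
RungLog ∧ RungTree ∧ RungRings — the ladder lies inside the target — and every rung is an ideal-gas
statement. [difficulty: provable-now] [Spohn1991, arXiv:2503.01800]

TWO-LAYER PLAN. Foreseen glued splits (none filed now): RungLog ⇐ DilutionAtContact(κ log N) →
IdealClosureToEuler → RungLog (k = 2: a quantitative statement that pre-collisional pair statistics
at contact are asymptotically product although all pairs share ancestors — currency supplied by
whichever engine docks first: mutual information along the collision DAG
(information-percolation-collision-dag), finite-window LD functionals at σ = 0
(kinetic-windows-inside-yau), or cumulants re-centred on local equilibrium (DenseKineticExpansion
0804 at vanishing φ) — plus the standard closure ⇒ ideal Euler step by Hilbert/Caflisch expansion or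
relative-energy weak–strong uniqueness); RungRings ⇐ RungRings(δ < 1/4) → RungRings(δ ≥ 1/4) →
RungRings (the two ring thresholds) or RungRings ⇐ RingBookkeeping → TreeMethodTransfer → RungRings;
LadderTop ⇐ LadderTop(σ = 0) → LadderTop(σ > 0) → LadderTop, the σ > 0 child fed by the
fixed-density engines (DenseKineticExpansion 0804/0805, DissipativeWeakStrong 0823).

KILL CRITERIA. ¬RungLog (a logarithmic scaling κ log N along which local-Gibbs hard spheres provably
leave the ideal Euler solution before the shock) closes the route `refuted:RungLog` and is the
sharpest evidence on record against the conjunct's mechanism — hand the witness to the negative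
side. ¬RungRings with RungTree standing ⇒ rings are lethal already at vanishing fraction: pivot
(route edit) to "rings need equilibrium cancellations" and re-rank a RingBookkeeping crux first
(dock ring-sparse-collision-forest B3). ¬LadderTop by an exotic scaling only (oscillating (N+1)ε³,
say) ⇒ restate LadderTop over eventually monotone scalings (`--restate`, not a close).
HydrodynamicLimit proved by another route moots the Assembly, not the rungs (they remain wanted
siblings at low staffing). A proof of RungLog by a method that demonstrably needs disjoint histories
falsifies Thesis A (the diagnosis) and sends the route to retriage, not to close.

NOT DECOMPOSED YET. The DILUTION PRINCIPLE itself (no typed currency until an engine docks: MI at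
contact, re-centred cumulants, or window LD); the HORIZON LEMMA S1 and RING-RATE LEMMA S2 of the
card (filed right after open as informal support items with one definition request — backward
clusters / recollision counts along `Literature.Analysis.FluidPDE.IsHardSphereTrajectory`, shared
with ring-sparse-collision-forest B4 and information-percolation-collision-dag); the second ring
threshold δ = 1/4 inside RungRings; the DHM floor (α_N ≪ (log log N)^(1/2): arXiv:2503.01800 Thm 3
is a claim under review and the tree's `deng_hani_ma_hilbert6` is the incompressible row only — no
rung filed there); the card's dimension axis (clause 4) — owned by card large-dimension-ladder and
kept out after the refutation of hilbert-six-in-log-dimensions; velocity-tail inputs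
(apriori-tails-and-rattlers) common to all rungs; a Literature-side `HydrodynamicLimitAlong ε σ`
packaging the common body of the four typed items.

CHEAPEST FALSIFIER. (a) One page of arithmetic (re-run by the card's refuter, confirmed with the
refinement 1/4): φ_N = α_N^(3/2)N^(−1/2); horizon α_N t* = log N/c; three-body rate α_Nφ_N ⇒
threshold δ = 1/5; ring rate α_Nφ_N² ⇒ δ = 1/4 — a different exponent moves a rung boundary, it
cannot remove the ladder. (b) Lean, done here: all eight items elaborate and `closes` is PROVED
(Sketch.lean rc 0, 2026-08-15); the three supports are provable now (hsPressure_zero,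
inverseKnudsen_hsDiameter_tendsto_atTop, succ_mul_hsDiameter_pow_three in-tree); vacuity is guarded
(0 < ε_N < 1/2 for all N so Alexander flows exist, `HardSphereFlow.nonempty_torus_holds`; classes
inhabited) — a grounder finding a degenerate ε making a rung trivially true kills the typing, not
the line. (c) MD later (kit): pre-collisional pair correlation at contact versus α_N t/log N at
Boltzmann–Grad-like density — monotone growth after the horizon predicts ¬RungLog.

NUMBERS. α_N := (N+1)ε_N² (collisions per particle per unit macroscopic time ≍ Kn⁻¹); φ_N :=
(N+1)ε_N³ = α_N^(3/2)(N+1)^(−1/2); conjunct: α_N = σ²(N+1)^(1/3), φ = σ³ (in-tree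
succ_mul_hsDiameter_pow_three, inverseKnudsen_hsDiameter_tendsto_atTop); printed frontier:
max(1,α)·max(1,αT) ≪ (log|log ε|)^(1/2) (arXiv:2503.01800 (1.24) p. 8, Thm 3 p. 11, Part 7 p. 65: L
= κ(log|log ε|)^(1/2) layers), α ≪ √(log log N) (arXiv:1305.3397 p. 7); backward clusters at α = 1:
mean cardinality bounded uniformly in N on bounded times, P(|BC| = k) ≤ Ct·exp(−k^(1/(Ct))/4), S(t)
= O(e^(C′t log t)) (arXiv:2005.09962 Thm 2.1), dynamical (Bogolyubov) clusters percolate to size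
O(N) near one mean free time (ibid. §1.1); horizon: α_N t* ≍ log N ⇒ t* → 1/(cκ) on RungLog, → 0
above; events per particle per unit time: three-body ≍ α_N^(5/2)N^(−1/2) (→ 0 iff δ < 1/5), genuine
recollisions ≍ α_N⁴N^(−1) (→ 0 iff δ < 1/4); at δ = 1/3 the fractions per collision are ≍ σ³, σ⁶.
Items at open: 8 typed (target, 3 cruxes, 3 supports, assembly) + deciding theorem `closes`; 2
informal supports (HorizonLemma = stmt-AtomisticToContinuum-5370, RingRateLemma =
stmt-AtomisticToContinuum-5451) and the definition request defn-BackwardCluster already filed on the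
retired predecessor and re-attached after open.

DEFINITION REQUESTS. (D1) `BackwardCluster` and the recollision count of a tagged particle over a
time window along `Literature.Analysis.FluidPDE.IsHardSphereTrajectory` / `HardSphereFlow`
(arXiv:2005.09962 §1.1; doi:10.1142/s0218202515500256), topic
Literature/MathematicalPhysics/KineticTheory — for the informal supports HorizonLemma (under the
canonical Gibbs law at any ladder scaling, e^(c₁α_N t) ∧ N ≲ E|BC_t| ≲ e^(c₂α_N t·log⁺(α_N t)) ∧
(N+1)) and RingRateLemma (expected ring-type events of a tagged particle on [0,t] ≤ Ct·α_Nφ_N,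
genuine recollisions ≤ Ct·α_Nφ_N²). (D2, later) Literature-side `HydrodynamicLimitAlong (ε : ℕ → ℝ)
(σ : ℝ) : Prop` = the common body of LadderTop/Rung* (local Gibbs law at diameter ε N via
particleLaw/canonicalDensity/localGibbsProfile, Euler target IsHardSphereEulerSolution σ), so that
engine routes state rung-indexed cruxes in one line. No cite facts wanted: every crux is
self-contained over the prelude.

Novelty: Searches (2026-08-15): `lit search --hybrid "Boltzmann-Grad limit diverging collision rate
hydrodynamic limit hard spheres intermediate scaling"` (12 rows: Spohn1991, CIP1994,
SaintRaymond2009, KipnisLandim1999 textbooks — nothing intermediate); `lit search --source crossref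
"hydrodynamic limit hard spheres Euler equations low density scaling"` (10, none relevant);
`--source zbmath "Boltzmann-Grad limit long time hard spheres"` (3, none); arXiv / OpenAlex / S2
back-ends rate-limited (HTTP 429) during the session; `lit frontier AtomisticToContinuum --since
2023` (30 rows; DHM descendants arXiv:2602.04407, doi:10.1007/s10955-026-03570-w, arXiv:2605.19694,
arXiv:2605.19696, arXiv:2603.23298 — none treats α_N between (log log N)^(1/2) and N^(1/3)); `lit
bridges AtomisticToContinuum --cross any` (30; doi:10.1090/bull/1650); `lit galaxy search … --star
all` ×5 (2 substring queries 0 hits, 3 queued out — service saturated); `lit read` arXiv:2503.01800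
(pp. 8, 11, 65), arXiv:1305.3397 (p. 7), arXiv:2005.09962 (pp. 2–4), book:dorfman1999 pp. 191–198;
plus the card's refuter audit (2026-08-15: doi:10.1103/physrevlett.80.2035, Elskens–Frisch,
Frisch–Percus, MKZ). Routes read: all five theses of the sub; cards read: large-dimension-ladder,
hilbert-six-in-log-dimensions (retired), information-percolation-collision-dag,
ring-sparse-collision-forest, iterated-limit-euler-finite-windows.
Nearest prior art found: arXiv:2503.01800 Thm 3 with (1.24) (ideal-gas Euler for α ≲ (log
log)^(1/2), cla  [refs: 10.1007/s10955-026-03570-w, 10.1090/bull/1650, 10.1103/physrevlett.80.2035, 10.1142/s0218202515500256, 2602.04407, 2605.19694, 2605.19696, 2603.23298, 2503.01800, 1305.3397, 2005.09962, doi:10.1007/s10955-026-03570-w, doi:10.1090/bull/1650, book:dorfman1999, doi:10.1103/physrevlett.80.2035, doi:10.1142/s0218202515500256, Spohn1991, CIP1994, SaintRaymond2009, KipnisLandim1999, Cohen1967]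

Barriers (technique_class: regime-decomposition, scaling-ladder, branching-horizon): - technique_class: regime-decomposition, scaling-ladder, branching-horizon
- Literature.Barriers.AtomisticToContinuum.DiluteRegimeBarrier: the line LIVES on it and says so —
every σ = 0 rung is dilute with the ideal law by the barrier's kernels (a), (h) and implies nothing
about the conjunct (scope caveat (4): the separation from dilute results is rate-independent); what
the route adds sits inside kernel (d): the gap (log log N)^(1/2) → N^(1/3) is subdivided by the
horizon and ring thresholds into typed statements; the σ > 0 corner of LadderTop is the conjunct
itself — it does not evade; the bet is that the conjunct's first unknown is already present, in pure
form, at α_N = κ log N.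
- Literature.Barriers.AtomisticToContinuum.NoDensityExpansionBarrier: clause (2) (term-by-term
dynamical cluster expansions grow like (t/t_c)^(l−2)) hits any expansion-based attack past the
horizon — the route prescribes none; RungTree sits where there are no rings to resum at all, so a
method failing there fails for a reason other than this barrier (diagnostic value), and RungRings is
where the barrier's ring sector first enters, at vanishing order φ_N → 0; clause (1) (non-analytic
transport) is Navier–Stokes order, not met at Euler scaling.
- Literature.Barriers.AtomisticToContinuum.BoltzmannHypothesisBarrier: not engaged (no
classification of invariant states is used or claimed); the rungs are where entropy-method engines
can be tested free of fixed-density inputs.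
- Literature.Barriers.Atomist

Novelty grade: new-combination — ROUTE REVIEW rreview-0815T13-6 (refuter). Novelty INHERITED from the card audit (new-combination, structural regime map; not re-audited). All 8 items elaborate (scratch copy R2.lean rc0); `closes : LadderTop → ConjunctOnLadder → HydrodynamicLimit` re-elaborates sorry-free, std axioms — repairing the (refuter refuter-rreview-0815T13-6-0, 2026-08-15T14:16:46Z; prior: arXiv:2503.01800 (Deng–Hani–Ma Thm 3, (1.24)); arXiv:1305.3397; arXiv:2005.09962; doi:10.1103/physrevlett.80.2035; Cohen1967; book:dorfman1999 Ch.16/18; retired predecessor route-AtomisticToContinuum-AlphaLadder (not-a-thesis, formal))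

History (route lifecycle, newest last):
- 2026-08-16T03:05:24Z · CLOSED retired — not-a-thesis: target-unreachable — no item concludes the target LadderTop and no honest glue exists (the cruxes RungLog/RungTree/RungRings are σ=0 corollaries OF the target; any `Crux… → LadderTop` gl (planner-rchoice-AtomisticToContinuum-AlphaScal-0035482b-0)

sub-problem: HydrodynamicLimit · status: closed(retired) · opened planner-plancard-AtomisticToContinuum-Hydrody-0352b627-0 2026-08-15T13:43:16Z · rev 4 · ledger route-AtomisticToContinuum-AlphaScalingLadder
GENERATED by the gate from the ledger (D-0016/17). Provers cite these decls: `theorem foo : Summit.AtomisticToContinuum.HydrodynamicLimit.Theses.AlphaScalingLadder.<Decl> := …` in Summits/AtomisticToContinuum/HydrodynamicLimit/Theorems/<Name>.lean.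
-/

namespace Summit.AtomisticToContinuum.HydrodynamicLimit.Theses.AlphaScalingLadder

open scoped BigOperators Topology Manifold Classical MeasureTheory ProbabilityTheory Matrix InnerProductSpace ComplexConjugate ContinuousMap
open Filter Set Function TopologicalSpace MeasureTheory

attribute [summit_statement] _root_.HydrodynamicLimit

/-- item stmt-AtomisticToContinuum-8913 · target · rank 0 · closed · moot by None · by planner
why it might fail: Strictly stronger than the conjunct (LadderTop ⊋ HydrodynamicLimit, refuter evidence): uniform over ALL admissible scalings (σ=0 rungs; σ>0 with non-constant (N+1)ε³; non-monotone α_N) — an exotic sequence may fail while the conjunct holds; its σ>0 corner IS the open conjunct (arXiv:2602.04407 §5).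
sources: Spohn1991, OllaVaradhanYau1993, DengHaniMa2024, arXiv:2503.01800, arXiv:2602.04407
[target] LADDER TOP — the hydrodynamic limit UNIFORMLY ALONG EVERY ADMISSIBLE SCALING: for all
continuous profiles (a₀, θ₀ > 0, u₀) there is σ₀ > 0 such that for every σ ∈ [0, σ₀) and every
diameter sequence 0 < ε_N < 1/2 with α_N := (N+1)ε_N² → ∞ and (N+1)ε_N³ → σ³, every classical
hs-Euler solution with equation of state hsPressure σ on [0,T) and every family of flows:
local-Gibbs fields converging at t = 0 converge at every t < T. Its σ > 0 corner with ε = hsDiameter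
σ is the conjunct (ConjunctOnLadder, Assembly); its σ = 0 members contain the three rungs
(RungsAreLadderScalings) with the IDEAL-gas law (in-tree
Literature.Barriers.AtomisticToContinuum.hsPressure_zero). -/
@[route_item "route-AtomisticToContinuum-AlphaScalingLadder"]
def LadderTop : Prop :=
  ∀ (a₀ θ₀ : Literature.MathematicalPhysics.KineticTheory.T3 → ℝ) (u₀ : Literature.MathematicalPhysics.KineticTheory.T3 → Literature.MathematicalPhysics.KineticTheory.V3), Continuous a₀ → Continuous θ₀ → Continuous u₀ → (∀ x, 0 < a₀ x) → (∀ x, 0 < θ₀ x) → ∃ σ₀ : ℝ, 0 < σ₀ ∧ ∀ σ : ℝ, 0 ≤ σ → σ < σ₀ → ∀ ε : ℕ → ℝ, (∀ N : ℕ, 0 < ε N ∧ ε N < 2⁻¹) → Filter.Tendsto (fun N : ℕ => ((N : ℝ) + 1) * ε N ^ 2) Filter.atTop Filter.atTop → Filter.Tendsto (fun N : ℕ => ((N : ℝ) + 1) * ε N ^ 3) Filter.atTop (nhds (σ ^ 3)) → ∀ (T : ℝ) (ρ θ : ℝ → Literature.MathematicalPhysics.KineticTheory.T3 → ℝ) (u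 : ℝ → Literature.MathematicalPhysics.KineticTheory.T3 → Literature.MathematicalPhysics.KineticTheory.V3), Literature.MathematicalPhysics.KineticTheory.IsHardSphereEulerSolution σ T ρ u θ → ∀ Φ : (N : ℕ) → Literature.Analysis.FluidPDE.HardSphereFlow (Literature.Analysis.FluidPDE.Torus.geometry (Fin 3)) (ε N) (N + 1), Literature.MathematicalPhysics.KineticTheory.TendstoHydroFieldsAt (fun N => Literature.Analysis.FluidPDE.particleLaw (Φ N) (Literature.Analysis.FluidPDE.canonicalDensity (Literature.Analysis.FluidPDE.Torus.geometry (Fin 3)) (ε N) (N + 1) (Literature.MathematicalPhysics.KineticTheory.localGibbsProfile a₀ u₀ θ₀))) Φ ρ u θ 0 → ∀ t ∈ Set.Ico 0 T, Literature.MathematicalPhysics.KineticTheory.TendstoHydroFieldsAt (fun N => Literature.Analysis.FluidPDE.particleLaw (Φ N) (Literature.Analysis.FluidPDE.canonicalDensity (Literature.Analysis.FluidPDE.Torus.geometry (Fin 3)) (ε N) (N + 1) (Literature.MathematicalPhysics.KineticTheory.localGibbsProfile a₀ u₀ θ₀))) Φ ρ u θ t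

/-- item stmt-AtomisticToContinuum-8914 · crux · rank 2 · closed · moot by None · by planner
why it might fail: No printed method applies: Lanford→DHM need near-disjoint collision histories, α·T≲(log log N)^1/2 (arXiv:2503.01800 (1.16),(1.24)), on R^d only (BFK dispersion fails on T^3: arXiv:2602.04407 Rem 4.5); at α_N=κlog N backward clusters reach size N by t≍1/(cκ) (arXiv:2005.09962 Thm 2.1).
sources: arXiv:2503.01800, DengHaniMa2024, arXiv:2602.04407, BodineauGallagherSaintRaymondInvent2016, arXiv:2005.09962, doi:10.1103/physrevlett.80.2035
[crux] RUNG (i) — EULER PAST THE BRANCHING HORIZON (card K1): for every κ > 0 and every diameter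
sequence 0 < ε_N < 1/2 with (N+1)ε_N²/log(N+2) → κ (logarithmic collision number α_N ~ κ log N,
volume fraction → 0, Kn ≍ 1/(κ log N) → 0), hard spheres on 𝕋³ with local-Gibbs data follow the
classical IDEAL-gas Euler solution (IsHardSphereEulerSolution 0) in probability at every t < T, for
every classical lifespan T — in particular beyond the horizon time t* ≍ 1/(cκ) after which every
pair of particles shares collision ancestors. [difficulty: open-problem] -/
@[route_item "route-AtomisticToContinuum-AlphaScalingLadder"]
def RungLog : Prop :=
  ∀ κ : ℝ, 0 < κ → ∀ ε : ℕ → ℝ, (∀ N : ℕ, 0 < ε N ∧ ε N < 2⁻¹) → Filter.Tendsto (fun N : ℕ => ((N : ℝ) + 1) * ε N ^ 2 / Real.log ((N : ℝ) + 2)) Filter.atTop (nhds κ) → ∀ (a₀ θ₀ : Literature.MathematicalPhysics.KineticTheory.T3 → ℝ) (u₀ : Literature.MathematicalPhysics.KineticTheory.T3 → Literature.MathematicalPhysics.KineticTheory.V3), Continuous a₀ → Continuous θ₀ → Continuous u₀ → (∀ x, 0 < a₀ x) → (∀ x, 0 < θ₀ x) → ∀ (T : ℝ) (ρ θ : ℝ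 → Literature.MathematicalPhysics.KineticTheory.T3 → ℝ) (u : ℝ → Literature.MathematicalPhysics.KineticTheory.T3 → Literature.MathematicalPhysics.KineticTheory.V3), Literature.MathematicalPhysics.KineticTheory.IsHardSphereEulerSolution 0 T ρ u θ → ∀ Φ : (N : ℕ) → Literature.Analysis.FluidPDE.HardSphereFlow (Literature.Analysis.FluidPDE.Torus.geometry (Fin 3)) (ε N) (N + 1), Literature.MathematicalPhysics.KineticTheory.TendstoHydroFieldsAt (fun N => Literature.Analysis.FluidPDE.particleLaw (Φ N) (Literature.Analysis.FluidPDE.canonicalDensity (Literature.Analysis.FluidPDE.Torus.geometry (Fin 3)) (ε N) (N + 1) (Literature.MathematicalPhysics.KineticTheory.localGibbsProfile a₀ u₀ θ₀))) Φ ρ u θ 0 → ∀ t ∈ Set.Ico 0 T, Literature.MathematicalPhysics.KineticTheory.TendstoHydroFieldsAt (fun N => Literature.Analysis.FluidPDE.particleLaw (Φ N) (Literature.Analysis.FluidPDE.canonicalDensity (Literature.Analysis.FluidPDE.Torus.geometry (Fin 3)) (ε N) (N + 1) (Literature.MathematicalPhysics.KineticTheory.localGibbsProfile a₀ u₀ θ₀)))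 Φ ρ u θ t

/-- item stmt-AtomisticToContinuum-8915 · crux · rank 3 · closed · moot by None · by planner
why it might fail: Kn≍N^-δ: horizon time δlog N/(cN^δ)→0, so all of (0,T) lies past the horizon with total history overlap; nothing is printed for α_N→∞ polynomially (BGSSAnnals2023/BGSSCPAM2023 at α=O(1); DHM (log log N)^1/2); 'no rings' is an equilibrium rate count (Cohen1967 §2), unproved for the driven flow.
sources: BGSSAnnals2023, BGSSCPAM2023, Cohen1967, arXiv:2005.09962, arXiv:2503.01800, PulvirentiSimonella2016
[crux] RUNG (ii) — THE TREE REGIME: for every 0 < δ < 1/5, c > 0 and every diameter sequence 0 < ε_N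
< 1/2 with (N+1)ε_N²/(N+1)^δ → c, the same conclusion (ideal-gas Euler, every t < T). Here the
horizon time ≍ δ log N/(cN^δ) → 0 (the whole interval is past the horizon) while the expected number
of three-body/ring events per particle on [0,T] is ≍ T·N^(5δ/2−1/2) → 0: a typical particle's entire
macroscopic history is a collision TREE. [deps: RungLog] [difficulty: open-problem] -/
@[route_item "route-AtomisticToContinuum-AlphaScalingLadder"]
def RungTree : Prop :=
  ∀ δ : ℝ, 0 < δ → δ < 1 / 5 → ∀ c : ℝ, 0 < c → ∀ ε : ℕ → ℝ, (∀ N : ℕ, 0 < ε N ∧ ε N < 2⁻¹) → Filter.Tendsto (fun N : ℕ => ((N : ℝ) + 1) * ε N ^ 2 / ((N : ℝ) + 1) ^ δ) Filter.atTop (nhds c) → ∀ (a₀ θ₀ : Literature.MathematicalPhysics.KineticTheory.T3 → ℝ) (u₀ : Literature.MathematicalPhysics.KineticTheory.T3 → Literature.MathematicalPhysics.KineticTheory.V3), Continuous a₀ → Continuous θ₀ → Continuous u₀ → (∀ x, 0 < a₀ x) → (∀ x, 0 < θ₀ x) → ∀ (T : ℝ) (ρ θ : ℝ → Literature.MathematicalPhysics.KineticTheory.T3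 → ℝ) (u : ℝ → Literature.MathematicalPhysics.KineticTheory.T3 → Literature.MathematicalPhysics.KineticTheory.V3), Literature.MathematicalPhysics.KineticTheory.IsHardSphereEulerSolution 0 T ρ u θ → ∀ Φ : (N : ℕ) → Literature.Analysis.FluidPDE.HardSphereFlow (Literature.Analysis.FluidPDE.Torus.geometry (Fin 3)) (ε N) (N + 1), Literature.MathematicalPhysics.KineticTheory.TendstoHydroFieldsAt (fun N => Literature.Analysis.FluidPDE.particleLaw (Φ N) (Literature.Analysis.FluidPDE.canonicalDensity (Literature.Analysis.FluidPDE.Torus.geometry (Fin 3)) (ε N) (N + 1) (Literature.MathematicalPhysics.KineticTheory.localGibbsProfile a₀ u₀ θ₀))) Φ ρ u θ 0 → ∀ t ∈ Set.Ico 0 T, Literature.MathematicalPhysics.KineticTheory.TendstoHydroFieldsAt (fun N => Literature.Analysis.FluidPDE.particleLaw (Φ N) (Literature.Analysis.FluidPDE.canonicalDensity (Literature.Analysis.FluidPDE.Torus.geometry (Fin 3)) (ε N) (N + 1) (Literature.MathematicalPhysics.KineticTheory.localGibbsProfile a₀ u₀ θ₀))) Φ ρ u θ t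

/-- item stmt-AtomisticToContinuum-8916 · crux · rank 4 · closed · moot by None · by planner
why it might fail: For δ>1/5 three-body correlated sequences (≍N^((5δ−1)/2) per particle-time), for δ>1/4 genuine rings (≍N^(4δ−1)) stop vanishing: the hierarchy is not even formally closed on a typical history; ring bias at contact escapes entropy/energy bounds; no non-equilibrium ring estimate (Cohen1967 §2,4).
sources: Cohen1967, Dorfman1999, VanbeijerenErnst1973, arXiv:2503.01800, PulvirentiSimonella2016, BGSSCPAM2023
[crux] RUNG (iii) — STATISTICALLY DILUTE RINGS: for every 1/5 ≤ δ < 1/3, c > 0 and every diameter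
sequence 0 < ε_N < 1/2 with (N+1)ε_N²/(N+1)^δ → c, the same conclusion, still with the IDEAL-gas law
((N+1)ε_N³ = c^(3/2)N^(3δ/2−1/2)(1+o(1)) → 0); now three-body correlated sequences (δ ≥ 1/5) and
genuine recollision rings (δ ≥ 1/4) occur infinitely often per particle per unit time but are
vanishing fractions ≍ φ_N, φ_N² of its α_N collisions. [deps: RungTree] [difficulty: open-problem] -/
@[route_item "route-AtomisticToContinuum-AlphaScalingLadder"]
def RungRings : Prop :=
  ∀ δ : ℝ, 1 / 5 ≤ δ → δ < 1 / 3 → ∀ c : ℝ, 0 < c → ∀ ε : ℕ → ℝ, (∀ N : ℕ, 0 < ε N ∧ ε N < 2⁻¹) → Filter.Tendsto (fun N : ℕ => ((N : ℝ) + 1) * ε N ^ 2 / ((N : ℝ) + 1) ^ δ) Filter.atTop (nhds c) → ∀ (a₀ θ₀ : Literature.MathematicalPhysics.KineticTheory.T3 → ℝ) (u₀ : Literature.MathematicalPhysics.KineticTheory.T3 → Literature.MathematicalPhysics.KineticTheory.V3), Continuous a₀ → Continuous θ₀ → Continuous u₀ → (∀ x, 0 < a₀ x) → (∀ x, 0 <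 θ₀ x) → ∀ (T : ℝ) (ρ θ : ℝ → Literature.MathematicalPhysics.KineticTheory.T3 → ℝ) (u : ℝ → Literature.MathematicalPhysics.KineticTheory.T3 → Literature.MathematicalPhysics.KineticTheory.V3), Literature.MathematicalPhysics.KineticTheory.IsHardSphereEulerSolution 0 T ρ u θ → ∀ Φ : (N : ℕ) → Literature.Analysis.FluidPDE.HardSphereFlow (Literature.Analysis.FluidPDE.Torus.geometry (Fin 3)) (ε N) (N + 1), Literature.MathematicalPhysics.KineticTheory.TendstoHydroFieldsAt (fun N => Literature.Analysis.FluidPDE.particleLaw (Φ N) (Literature.Analysis.FluidPDE.canonicalDensity (Literature.Analysis.FluidPDE.Torus.geometry (Fin 3)) (ε N) (N + 1) (Literature.MathematicalPhysics.KineticTheory.localGibbsProfile a₀ u₀ θ₀))) Φ ρ u θ 0 → ∀ t ∈ Set.Ico 0 T, Literature.MathematicalPhysics.KineticTheory.TendstoHydroFieldsAt (fun N => Literature.Analysis.FluidPDE.particleLaw (Φ N) (Literature.Analysis.FluidPDE.canonicalDensity (Literature.Analysis.FluidPDE.Torus.geometry (Fin 3)) (ε N) (N + 1) (Literature.MathematicalPhysics.KineticTheory.localGibbsProfile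 a₀ u₀ θ₀))) Φ ρ u θ t

/-- item stmt-AtomisticToContinuum-8917 · support · rank 9 · closed · moot by None · by planner
sources: Spohn1991, GST2013
[support] the conjunct's own scaling is a ladder scaling with limit σ: for 0 < σ < 1/2 one has 0 <
hsDiameter σ N < 1/2 for all N, (N+1)·hsDiameter σ N² → ∞ (in-tree
Literature.Barriers.AtomisticToContinuum.inverseKnudsen_hsDiameter_tendsto_atTop) and
(N+1)·hsDiameter σ N³ → σ³ (it is identically σ³,
Literature.MathematicalPhysics.KineticTheory.succ_mul_hsDiameter_pow_three); with it the Assembly is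
a two-line specialisation. [difficulty: provable-now] -/
@[route_item "route-AtomisticToContinuum-AlphaScalingLadder"]
def ConjunctOnLadder : Prop :=
  ∀ σ : ℝ, 0 < σ → σ < 2⁻¹ → (∀ N : ℕ, 0 < Literature.MathematicalPhysics.KineticTheory.hsDiameter σ N ∧ Literature.MathematicalPhysics.KineticTheory.hsDiameter σ N < 2⁻¹) ∧ Filter.Tendsto (fun N : ℕ => ((N : ℝ) + 1) * Literature.MathematicalPhysics.KineticTheory.hsDiameter σ N ^ 2) Filter.atTop Filter.atTop ∧ Filter.Tendsto (fun N : ℕ => ((N : ℝ) + 1) * Literature.MathematicalPhysics.KineticTheory.hsDiameter σ N ^ 3) Filter.atTop (nhds (σ ^ 3))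

/-- item stmt-AtomisticToContinuum-8918 · support · rank 9 · closed · moot by None · by planner
sources: Spohn1991, Alexander1975
[support] non-vacuity of the rung hypotheses: for every κ > 0 (resp. every δ ∈ (0, 1/3) and c > 0)
there is a diameter sequence with 0 < ε_N < 1/2 for all N and (N+1)ε_N²/log(N+2) → κ (resp.
(N+1)ε_N²/(N+1)^δ → c) — e.g. ε_N = min(1/4, (κ log(N+2)/(N+1))^(1/2)), which agrees with the square
root for all large N. [difficulty: provable-now] -/
@[route_item "route-AtomisticToContinuum-AlphaScalingLadder"]
def RungClassesInhabited : Prop :=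
  (∀ κ : ℝ, 0 < κ → ∃ ε : ℕ → ℝ, (∀ N : ℕ, 0 < ε N ∧ ε N < 2⁻¹) ∧ Filter.Tendsto (fun N : ℕ => ((N : ℝ) + 1) * ε N ^ 2 / Real.log ((N : ℝ) + 2)) Filter.atTop (nhds κ)) ∧ (∀ δ : ℝ, 0 < δ → δ < 1 / 3 → ∀ c : ℝ, 0 < c → ∃ ε : ℕ → ℝ, (∀ N : ℕ, 0 < ε N ∧ ε N < 2⁻¹) ∧ Filter.Tendsto (fun N : ℕ => ((N : ℝ) + 1) * ε N ^ 2 / ((N : ℝ) + 1) ^ δ) Filter.atTop (nhds c))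

/-- item stmt-AtomisticToContinuum-8919 · support · rank 9 · closed · moot by None · by planner
sources: Spohn1991, arXiv:2503.01800
[support] every rung scaling is a ladder scaling with σ = 0: a positive diameter sequence of
logarithmic class ((N+1)ε²/log(N+2) → κ > 0) or power class ((N+1)ε²/(N+1)^δ → c > 0, 0 < δ < 1/3)
has (N+1)ε_N² → ∞ and (N+1)ε_N³ → 0; hence LadderTop (σ = 0 member) implies RungLog ∧ RungTree ∧
RungRings — the ladder lies inside the target — and every rung is an ideal-gas statement.
[difficulty: provable-now] -/
@[route_item "route-AtomisticToContinuum-AlphaScalingLadder"]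
def RungsAreLadderScalings : Prop :=
  ∀ ε : ℕ → ℝ, (∀ N : ℕ, 0 < ε N) → ((∃ κ : ℝ, 0 < κ ∧ Filter.Tendsto (fun N : ℕ => ((N : ℝ) + 1) * ε N ^ 2 / Real.log ((N : ℝ) + 2)) Filter.atTop (nhds κ)) ∨ (∃ δ : ℝ, 0 < δ ∧ δ < 1 / 3 ∧ ∃ c : ℝ, 0 < c ∧ Filter.Tendsto (fun N : ℕ => ((N : ℝ) + 1) * ε N ^ 2 / ((N : ℝ) + 1) ^ δ) Filter.atTop (nhds c))) → Filter.Tendsto (fun N : ℕ => ((N : ℝ) + 1) * ε N ^ 2) Filter.atTop Filter.atTop ∧ Filter.Tendsto (fun N : ℕ => ((N : ℝ) + 1) * ε N ^ 3) Filter.atTop (nhds 0)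

-- item stmt-AtomisticToContinuum-9461 · support · rank 9 · closed · moot by None · by planner — informal only, no Lean statement yet:
--   [support] HORIZON LEMMA (card S1; provable-now modulo the definition request defn-BackwardCluster):
--   for every ladder scaling (0 < ε_N < 1/2, α_N := (N+1)ε_N² → ∞, (N+1)ε_N³ → σ³ with σ small) and
--   under the canonical hard-sphere Gibbs law on 𝕋³ (canonicalDensity of a uniform Maxwellian profile at
--   diameter ε_N), the backward cluster BC_t(i) of a tagged sphere over macroscopic time t
--   (Aoki–Pulvirenti–Simonella–Tsuji, doi:10.1142/s0218202515500256; Pulvirenti–Simonella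
--   arXiv:2005.09962 §1.1: going back from time t, add the first new collision partner of any current
--   member, iterate to time 0) satis

-- item stmt-AtomisticToContinuum-9471 · support · rank 9 · closed · moot by None · by planner — informal only, no Lean statement yet:
--   [support] RING-RATE LEMMA (card S2; provable-now modulo defn-BackwardCluster / recollision count):
--   under the canonical hard-sphere Gibbs law on 𝕋³ at a ladder scaling (0 < ε_N < 1/2, α_N := (N+1)ε_N²
--   → ∞, φ_N := (N+1)ε_N³ → σ³, σ small), the expected number of RECOLLISIONS of a tagged sphere during
--   the macroscopic window [0, t] — collisions with a particle already in its backward cluster of the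
--   last M mean free times (arXiv:2005.09962 §1.1: collisions which do not involve a new particle) — is
--   at most C_M · t · (α_N φ_N) for three-body correlated sequences at the scale of the diameter
--   (Choh–Uhl

/-- item stmt-AtomisticToContinuum-8920 · assembly · rank 1 · closed · moot by None · by planner
sources: Spohn1991, OllaVaradhanYau1993
[assembly] LadderTop → ConjunctOnLadder → HydrodynamicLimit (the chain of the deciding theorem
`closes`, conclusion = the sub-problem Statement decl): given profiles, take σ₀' := min(σ₀, 1/2)
from LadderTop; for 0 < σ < σ₀' specialise to ε := hsDiameter σ, admissible with limit σ by
ConjunctOnLadder; localGibbsLaw σ a₀ u₀ θ₀ N (Φ N) unfolds to particleLaw (Φ N) (canonicalDensity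
(Torus.geometry (Fin 3)) (hsDiameter σ N) (N+1) (localGibbsProfile a₀ u₀ θ₀)), so hypothesis and
conclusion match the conjunct verbatim. -/
@[route_item "route-AtomisticToContinuum-AlphaScalingLadder"]
def Assembly : Prop :=
  LadderTop → ConjunctOnLadder → HydrodynamicLimit

end Summit.AtomisticToContinuum.HydrodynamicLimit.Theses.AlphaScalingLadder
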